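import Literature.MathematicalPhysics.QuantumFieldTheory.Dimock2011to13.QED3ScaledPathMetric
import HarnessLib

/-!
# Dimock, *QED on the 3-torus. II*, §3.2 (155) one link, single scale (Remark 3): the one-point block sum
# `Σ_{Δ′} e^{−O(1)d(Δ,Δ′)} ≤ O(1)` over block centres on a lattice — the hypothesis `hK` of the tree's random-walk
# engines DISCHARGED on `ℤ^ι` for the sup-norm distance, with the constant `(2∕(1 − e^{−κ∕|ι|}))^{|ι|}` explicit

statement-level skeleton of published theorems with citation tags; proofs where landed; nothing here is a claim about the Yang–Mills mass gap

**Citation header (reproduction of PUBLISHED work).** J. Dimock, *Quantum electrodynamics on the 3-torus. II*,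
arXiv:math-ph/0407063 [Dimock2004QED3TorusII], **§3.2** proof of THEOREM 1 Part III (152)–(155) p.24 L59 – p.25 L12,
Remark 3 p.22 L28–30, of the held arXiv text layer `paper:arxiv-math-ph_0407063` (`p.NN Lnn` = PDF page ∕ text-layer
line); for (155) the paper refers to T. Bałaban, *Propagators and renormalization transformations for lattice gauge
theories II*, Commun. Math. Phys. **96** (1984) 223–250, Lemma 2.1 (D13's reference [7], p.37 L12–13).  Writer seat p11
(literature-prover-lit-balaban-p11-g23-0), YM LIT SWEEP item (c) D13 (row C13 «WHERE»; zero weight for the YM-INPRINT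
tokens).  Serves the hypothesis `hK : ∀ y, Σ_u e^{−c·d(y,u)} ≤ K` of the tree's `RandomWalkExpansion.sum_exp_chainLen_le` ∕
`sum_exp_chain_le` (module docstring there: *"the one-link sum `Σ_u e^{−½γ₀d(y,u)} ≤ K` itself (a lattice fact, the
hypothesis `hK`)"*) and `hK : ∀ b, Σ_{b′} e^{−(c∕2)d(ctr b, ctr b′)} ≤ K` of `QED3SingularWalkBound.dimock195`,
`QED3WalkExpansionInverse.dimock_thm1`, `QED3BackgroundFieldSeries.dimock134_multiscale`.

**The printed text.** p.24 L59–62: *"Part III. Now we estimate the expansion. Besides the partition (122) we can also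
partition `L^{−k}Λ_0` into smaller blocks `Δ` of size `L^{−(k−i)}` in `δΛ^{(k)}_i`."*  (155) p.25 L2–10: *"We also use the
estimate `Σ_{Δ_1,…,Δ_n} e^{−O(1)d_Λ(x,Δ_1)}e^{−O(1)d_Λ(Δ_1,Δ_2)}⋯e^{−O(1)d_Λ(Δ_n,y)} ≤ (O(1))^n exp(−O(1)d_Λ(x,y))` (155)  For
this see [7], lemma 2.1."*  Remark 3 p.22 L28–30: *"It is possible that `Λ` is a sequence of the full tori … In this case
`d_Λ(x,y) = d(x,y)`"*.

**What is formalized (kernel-checked, zero `sorry`; Mathlib + the tree's `QED3ScaledPathMetric`).**  The tree reduces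
(155) to the ONE-LINK sum `Σ_{Δ′} e^{−(c∕2)d(Δ,Δ′)} ≤ K` (`RandomWalkExpansion.sum_exp_chain_le`: chain of `n` links
`≤ K^n e^{−(c∕2)d(x,y)}` by the triangle inequality) and takes `K` as a hypothesis.  Here that one-link sum is BOUNDED in
the single-scale member (Remark 3: one block size, `d` = a constant multiple of the sup-norm lattice distance, the tree's
`pathDist_const`):
* §1 `geom_partial_le` (`Σ_{s<n} q^s ≤ 1∕(1−q)`), **`sum_exp_neg_mul_natAbs_le`**: for every finite `T ⊂ ℤ`, `κ > 0`,
  `m₀ ∈ ℤ`: `Σ_{m∈T} e^{−κ|m−m₀|} ≤ 2∕(1 − e^{−κ})` (fibres of `m ↦ |m − m₀|` have `≤ 2` points, then a geometric sum).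
* §2 `exp_neg_mul_supDist_le_prod` (`e^{−κ‖m−n‖_∞} ≤ Π_μ e^{−(κ∕|ι|)|m_μ−n_μ|}`, from `|ι|·‖·‖_∞ ≥ ‖·‖_1`) and
  **`sum_exp_neg_mul_supDist_le`**: for every finite `S ⊂ ℤ^ι`, `κ > 0`, `m`:
  `Σ_{n∈S} e^{−κ·supDist m n} ≤ (2∕(1 − e^{−κ∕|ι|}))^{|ι|}` (sum over the product of the coordinate projections,
  `Finset.prod_univ_sum`).
* §3 the engines' shape: **`one_point_sum_le`** — blocks labelled by a `Fintype B` with injective index map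
  `idx : B → ℤ^ι` and `d(b,b′) = θ·supDist (idx b) (idx b′)`, `c, θ > 0`:
  `∀ b, Σ_{b′} e^{−c·d(b,b′)} ≤ (2∕(1 − e^{−cθ∕|ι|}))^{|ι|}`; and **`one_point_sum_pathDist_const_le`** — centres
  `ctr b = u₀ + s·idx b` (`s ≥ 1` the block side in lattice units) and the single-scale `d_Λ` = `pathDist (fun _ ↦ w)`
  (weight `w > 0`; `= w·supDist` by `pathDist_const`, `supDist_add_nsmul`): `Σ_{b′} e^{−c·d(ctr b, ctr b′)} ≤
  (2∕(1 − e^{−cws∕|ι|}))^{|ι|}` — for the blocks `Δ` of p.24 L59–62 (`s = L^i` lattice units, `w = a·L^{k−i}`, `ws = aL^k = 1`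
  on `T^{−k}`) the constant is `(2∕(1 − e^{−c∕|ι|}))^{|ι|}`, independent of `L`, `M_0`, `k` and the volume.
* §4 (v1.1, append-only) **the path-count hypotheses** of the same engines (`hadjcard`, `hS₀card`, `hS₁card`: *"`≤ ν`
  cubes adjacent to any cube (`ν = 27`)"*, *"`≤ ν` start cubes"*) in the single-scale member: `card_filter_supDist_le`
  (`#{n ∈ S : supDist m n ≤ s} ≤ (2s+1)^{|ι|}`), **`card_filter_le_of_supDist`** (labels `Z` with injective index: a
  predicate implying index sup-distance `≤ s` from a fixed point holds for `≤ (2s+1)^{|ι|}` labels) and **`adjcard_le`**: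
  the printed adjacency (132) p.22 L7–11 (*"`□_j, □_{j+1}` should touch, possibly only on corners, and including the
  possibility `□_j = □_{j+1}`"* = block indices at sup-distance `≤ 1`) has `≤ 3^{|ι|}` neighbours (`= 27` for `ι = Fin 3`);
  the start cubes (*"`ω : x → y` means `x ∈ □̃_0`"*, `□̃` the concentric `3M_0`-cube (126): index of `□_0` within `1` of the
  index of the `M_0`-cube of `x`) likewise.

**Honest scope.** Single scale only: for the MULTISCALE `d_Λ` of (127) with the regions `Λ` the uniform bound (155) is
Bałaban's Lemma 2.1 ([7]) and rests on the corridor geometry (92); it is not proved here.  The constant is not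
optimised (`‖·‖_∞ ≥ ‖·‖_1∕|ι|` loses a factor `|ι|` in the rate).  No torus identification (a finite set of lattice block
indices, as the engines' finite site types provide).  No named facts are introduced.
-/

namespace Literature.MathematicalPhysics.QuantumFieldTheory.Dimock2011to13

namespace QED3PathMetric

open Finset Real

variable {ι : Type*} [Fintype ι]

/-! ## §1 One dimension -/

omit [Fintype ι] in
/-- geometric partial sums: `Σ_{s<n} q^s ≤ 1∕(1−q)` for `0 ≤ q < 1`.
[cite: Dimock2004QED3TorusII, §3.2 (155) p.25 L2–10] -/
theorem geom_partial_le {q : ℝ} (hq0 : 0 ≤ q) (hq1 : q < 1) (n : ℕ) : ∑ s ∈ range n, q ^ s ≤ 1 / (1 - q) := by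
  rw [le_div_iff₀ (by linarith), geom_sum_mul_neg]
  have := pow_nonneg hq0 n
  linarith

omit [Fintype ι] in
/-- **one-dimensional one-point sum**: `Σ_{m∈T} e^{−κ|m−m₀|} ≤ 2∕(1 − e^{−κ})` for every finite `T ⊂ ℤ` and `κ > 0`.
[cite: Dimock2004QED3TorusII, §3.2 (155) p.25 L2–10] -/
theorem sum_exp_neg_mul_natAbs_le {κ : ℝ} (hκ : 0 < κ) (T : Finset ℤ) (m₀ : ℤ) :
    ∑ m ∈ T, exp (-(κ * ((m - m₀).natAbs : ℝ))) ≤ 2 / (1 - exp (-κ)) := by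
  classical
  set q : ℝ := exp (-κ) with hq
  have hq0 : 0 ≤ q := (exp_pos _).le
  have hq1 : q < 1 := by
    have h := Real.exp_lt_exp.2 (show -κ < 0 by linarith)
    rwa [Real.exp_zero] at h
  set g : ℤ → ℕ := fun m => (m - m₀).natAbs with hg
  have hterm : ∀ m : ℤ, exp (-(κ * ((m - m₀).natAbs : ℝ))) = q ^ g m := by
    intro m
    rw [hq, ← Real.exp_nat_mul]
    congr 1
    simp only [hg]
    ring
  simp_rw [hterm]
  -- group by the value of `g`; each fibre has at most two points `m₀ ± s`
  rw [Finset.sum_comp]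
  have hfib : ∀ s ∈ T.image g, (T.filter fun m => g m = s).card • q ^ s ≤ 2 * q ^ s := by
    intro s _
    rw [nsmul_eq_mul]
    refine mul_le_mul_of_nonneg_right ?_ (pow_nonneg hq0 s)
    have hsub : (T.filter fun m => g m = s) ⊆ ({m₀ + s, m₀ - s} : Finset ℤ) := by
      intro m hm
      rw [mem_filter] at hm
      have h2 := hm.2
      simp only [hg] at h2
      rw [mem_insert, mem_singleton]
      omega
    have hcard := (card_le_card hsub).trans (Finset.card_insert_le _ _)
    rw [card_singleton] at hcard
    exact_mod_cast hcard
  -- the values of `g` on `T` lie below some `N`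
  obtain ⟨N, hN⟩ : ∃ N, T.image g ⊆ range N :=
    ⟨(T.image g).sup id + 1, fun s hs => mem_range.2 (Nat.lt_succ_of_le (le_sup (f := id) hs))⟩
  calc ∑ s ∈ T.image g, (T.filter fun m => g m = s).card • q ^ s
      ≤ ∑ s ∈ T.image g, 2 * q ^ s := sum_le_sum hfib
    _ ≤ ∑ s ∈ range N, 2 * q ^ s :=
        sum_le_sum_of_subset_of_nonneg hN fun s _ _ => by positivity
    _ = 2 * ∑ s ∈ range N, q ^ s := by rw [mul_sum]
    _ ≤ 2 * (1 / (1 - q)) := by gcongr; exact geom_partial_le hq0 hq1 N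
    _ = 2 / (1 - q) := by ring

/-! ## §2 The sup-norm lattice `ℤ^ι` -/

/-- `e^{−κ‖m−n‖_∞} ≤ Π_μ e^{−(κ∕|ι|)|m_μ−n_μ|}` (`|ι|·supDist ≥ Σ_μ|m_μ − n_μ|`).
[cite: Dimock2004QED3TorusII, §3.2 (155) p.25 L2–10] -/
theorem exp_neg_mul_supDist_le_prod {κ : ℝ} (hκ : 0 ≤ κ) (m n : ι → ℤ) :
    exp (-(κ * (supDist m n : ℝ))) ≤ ∏ μ, exp (-(κ / Fintype.card ι * ((m μ - n μ).natAbs : ℝ))) := by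
  rw [← Real.exp_sum, Real.exp_le_exp, sum_neg_distrib, neg_le_neg_iff, ← mul_sum]
  have hsum : ∑ μ, ((m μ - n μ).natAbs : ℝ) ≤ Fintype.card ι * (supDist m n : ℝ) := by
    have h := Finset.sum_le_card_nsmul (univ : Finset ι) (fun μ => ((m μ - n μ).natAbs : ℝ)) (supDist m n : ℝ)
      fun μ _ => by exact_mod_cast natAbs_le_supDist m n μ
    rwa [card_univ, nsmul_eq_mul] at h
  by_cases hc : (Fintype.card ι : ℝ) = 0
  · rw [hc, div_zero, zero_mul]
    exact mul_nonneg hκ (Nat.cast_nonneg _)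
  · have hc' : (0 : ℝ) < Fintype.card ι := lt_of_le_of_ne (Nat.cast_nonneg _) (Ne.symm hc)
    calc κ / Fintype.card ι * ∑ μ, ((m μ - n μ).natAbs : ℝ)
        ≤ κ / Fintype.card ι * (Fintype.card ι * (supDist m n : ℝ)) :=
          mul_le_mul_of_nonneg_left hsum (div_nonneg hκ hc'.le)
      _ = κ * supDist m n := by field_simp

/-- **The one-point sum on `ℤ^ι`**: for every finite `S ⊂ ℤ^ι`, `κ > 0` and base point `m`,
`Σ_{n∈S} e^{−κ·supDist m n} ≤ (2∕(1 − e^{−κ∕|ι|}))^{|ι|}`.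
[cite: Dimock2004QED3TorusII, §3.2 (155) p.25 L2–10 («For this see [7], lemma 2.1»)] -/
theorem sum_exp_neg_mul_supDist_le [DecidableEq ι] {κ : ℝ} (hκ : 0 < κ) (S : Finset (ι → ℤ)) (m : ι → ℤ) :
    ∑ n ∈ S, exp (-(κ * (supDist m n : ℝ))) ≤ (2 / (1 - exp (-(κ / Fintype.card ι)))) ^ Fintype.card ι := by
  classical
  set f : ι → ℤ → ℝ := fun μ t => exp (-(κ / Fintype.card ι * ((m μ - t).natAbs : ℝ))) with hf
  have hf0 : ∀ μ t, 0 ≤ f μ t := fun μ t => (exp_pos _).le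
  -- coordinate projections of `S`
  set t : ι → Finset ℤ := fun μ => S.image fun n => n μ with ht
  have hsub : S ⊆ Fintype.piFinset t := fun n hn =>
    Fintype.mem_piFinset.2 fun μ => mem_image.2 ⟨n, hn, rfl⟩
  calc ∑ n ∈ S, exp (-(κ * (supDist m n : ℝ)))
      ≤ ∑ n ∈ S, ∏ μ, f μ (n μ) := sum_le_sum fun n _ => exp_neg_mul_supDist_le_prod hκ.le m n
    _ ≤ ∑ n ∈ Fintype.piFinset t, ∏ μ, f μ (n μ) :=
        sum_le_sum_of_subset_of_nonneg hsub fun n _ _ => prod_nonneg fun μ _ => hf0 μ (n μ)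
    _ = ∏ μ, ∑ s ∈ t μ, f μ s := (Finset.prod_univ_sum t f).symm
    _ ≤ ∏ _μ : ι, 2 / (1 - exp (-(κ / Fintype.card ι))) := by
        refine prod_le_prod (fun μ _ => sum_nonneg fun s _ => hf0 μ s) fun μ _ => ?_
        have hcard : (0 : ℝ) < Fintype.card ι := by
          exact_mod_cast Fintype.card_pos_iff.2 ⟨μ⟩
        have hκ' : 0 < κ / Fintype.card ι := div_pos hκ hcard
        have h := sum_exp_neg_mul_natAbs_le hκ' (t μ) (m μ)
        -- `|s − m_μ| = |m_μ − s|`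
        have e : ∀ s : ℤ, ((s - m μ).natAbs : ℝ) = ((m μ - s).natAbs : ℝ) := fun s => by
          rw [← Int.natAbs_neg, neg_sub]
        simp_rw [e] at h
        exact h
    _ = (2 / (1 - exp (-(κ / Fintype.card ι)))) ^ Fintype.card ι := by
        rw [prod_const, card_univ]

/-! ## §3 The engines' hypothesis `hK` -/

/-- **`hK` on a lattice of block indices**: blocks labelled by `B` with an injective index map `idx : B → ℤ^ι` and
`d(b,b′) = θ·supDist (idx b) (idx b′)` (`θ > 0`), `c > 0`: `Σ_{b′} e^{−c·d(b,b′)} ≤ (2∕(1 − e^{−cθ∕|ι|}))^{|ι|}` for every `b`.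
[cite: Dimock2004QED3TorusII, §3.2 (155) p.25 L2–10; Remark 3 p.22 L28–30] -/
theorem one_point_sum_le [DecidableEq ι] {B : Type*} [Fintype B] (idx : B → (ι → ℤ))
    (hidx : Function.Injective idx) {c θ : ℝ} (hc : 0 < c) (hθ : 0 < θ) (b : B) :
    ∑ b', exp (-c * (θ * (supDist (idx b) (idx b') : ℝ)))
      ≤ (2 / (1 - exp (-(c * θ / Fintype.card ι)))) ^ Fintype.card ι := by
  classical
  have e : ∑ b', exp (-c * (θ * (supDist (idx b) (idx b') : ℝ)))
      = ∑ n ∈ (univ : Finset B).image idx, exp (-(c * θ * (supDist (idx b) n : ℝ))) := by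
    rw [sum_image fun x _ y _ h => hidx h]
    refine sum_congr rfl fun b' _ => ?_
    congr 1; ring
  rw [e]
  exact sum_exp_neg_mul_supDist_le (mul_pos hc hθ) _ _

omit [Fintype ι] in
/-- scaling of the sup distance under `n ↦ u₀ + s·n` (block centres of side `s` in lattice units), coordinatewise.
[cite: Dimock2004QED3TorusII, §3.2 proof of Thm 1 Part III p.24 L59–62] -/
theorem natAbs_add_nsmul_sub (u₀ n n' : ι → ℤ) (s : ℕ) (μ : ι) :
    ((u₀ + s • n) μ - (u₀ + s • n') μ).natAbs = s * (n μ - n' μ).natAbs := by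
  show (u₀ μ + (s • n) μ - (u₀ μ + (s • n') μ)).natAbs = _
  rw [Pi.smul_apply, Pi.smul_apply, nsmul_eq_mul, nsmul_eq_mul,
    show (u₀ μ + (s : ℤ) * n μ) - (u₀ μ + (s : ℤ) * n' μ) = (s : ℤ) * (n μ - n' μ) by ring, Int.natAbs_mul]
  simp

/-- `supDist (u₀ + s·n) (u₀ + s·n′) = s·supDist n n′`.
[cite: Dimock2004QED3TorusII, §3.2 proof of Thm 1 Part III p.24 L59–62] -/
theorem supDist_add_nsmul (u₀ n n' : ι → ℤ) (s : ℕ) :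
    supDist (u₀ + s • n) (u₀ + s • n') = s * supDist n n' := by
  apply le_antisymm
  · rw [supDist_le_iff]
    intro μ
    rw [natAbs_add_nsmul_sub]
    exact Nat.mul_le_mul_left _ (natAbs_le_supDist n n' μ)
  · rcases Nat.eq_zero_or_pos s with hs | hs
    · rw [hs]; simp
    · rw [mul_comm, ← Nat.le_div_iff_mul_le hs, supDist_le_iff]
      intro μ
      rw [Nat.le_div_iff_mul_le hs, mul_comm, ← natAbs_add_nsmul_sub u₀ n n' s μ]
      exact natAbs_le_supDist _ _ μ

/-- **`hK` for the single-scale `d_Λ`** (Remark 3: one block size): blocks labelled by `B` with centres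
`ctr b = u₀ + s·idx b` (`idx` injective, `s ≥ 1` the block side in lattice units), the distance between centres being
the tree's `pathDist` with the constant weight `w > 0` (`= w·supDist`, `pathDist_const`), `c > 0`:
`Σ_{b′} e^{−c·d(ctr b, ctr b′)} ≤ (2∕(1 − e^{−cws∕|ι|}))^{|ι|}` for every `b` — for the blocks `Δ` of p.24 L59–62 on
`T^{−k}` (`s = L^i`, `w = L^{−k}·L^{k−i}`) `ws = 1` and the constant is `(2∕(1 − e^{−c∕|ι|}))^{|ι|}`.
[cite: Dimock2004QED3TorusII, §3.2 (155) p.25 L2–10; Remark 3 p.22 L28–30; proof of Thm 1 Part III p.24 L59–62] -/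
theorem one_point_sum_pathDist_const_le [DecidableEq ι] {B : Type*} [Fintype B] (idx : B → (ι → ℤ))
    (hidx : Function.Injective idx) (u₀ : ι → ℤ) {s : ℕ} (hs : 1 ≤ s) {c w : ℝ} (hc : 0 < c) (hw : 0 < w)
    (b : B) :
    ∑ b', exp (-c * pathDist (fun _ => w) (u₀ + s • idx b) (u₀ + s • idx b'))
      ≤ (2 / (1 - exp (-(c * (w * s) / Fintype.card ι)))) ^ Fintype.card ι := by
  have e : ∀ b', pathDist (fun _ => w) (u₀ + s • idx b) (u₀ + s • idx b')
      = (w * s) * (supDist (idx b) (idx b') : ℝ) := by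
    intro b'
    rw [pathDist_const hw.le, supDist_add_nsmul]
    push_cast
    ring
  simp_rw [e]
  exact one_point_sum_le idx hidx hc (mul_pos hw (by exact_mod_cast hs)) b

/-! ## §4 (v1.1) The path-count hypotheses: `≤ (2s+1)^{|ι|}` indices within sup-distance `s` -/

/-- **points of a finite `S ⊂ ℤ^ι` within sup-distance `s` of `m`: at most `(2s+1)^{|ι|}`** (they lie in the index cube
`Π_μ [m_μ − s, m_μ + s]`). [cite: Dimock2004QED3TorusII, §3.2 (132) p.22 L7–11; proof of Thm 1 Part III p.25 L10–12
(«we sum over paths»)] -/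
theorem card_filter_supDist_le [DecidableEq ι] (S : Finset (ι → ℤ)) (m : ι → ℤ) (s : ℕ) :
    (S.filter fun n => supDist m n ≤ s).card ≤ (2 * s + 1) ^ Fintype.card ι := by
  classical
  have hsub : (S.filter fun n => supDist m n ≤ s) ⊆ Fintype.piFinset fun μ => Icc (m μ - s) (m μ + s) := by
    intro n hn
    rw [mem_filter] at hn
    rw [Fintype.mem_piFinset]
    intro μ
    have h := natAbs_le_supDist m n μ
    have h2 := hn.2
    rw [mem_Icc]
    constructor <;> omega
  refine (card_le_card hsub).trans (le_of_eq ?_)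
  rw [Fintype.card_piFinset]
  have e : ∀ μ, (Icc (m μ - s) (m μ + s)).card = 2 * s + 1 := fun μ => by
    rw [Int.card_Icc]; omega
  simp_rw [e]
  rw [prod_const, card_univ]

/-- **at most `(2s+1)^{|ι|}` labels near a point**: blocks labelled by `Z` with an injective index map `idx : Z → ℤ^ι`; a
(decidable) predicate `P` that forces `supDist m (idx z′) ≤ s` holds for at most `(2s+1)^{|ι|}` labels — the shape of the
engines' `hS₀card` ∕ `hS₁card` (start cubes of a site: `s = 1` about the index of the site's `M_0`-cube, since
`ω : x → y` means `x ∈ □̃_0`, the concentric `3M_0`-cube). [cite: Dimock2004QED3TorusII, §3.2 (132) p.22 L7–11, (126) p.21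
L11–15; proof of Thm 1 Part III p.25 L10–12] -/
theorem card_filter_le_of_supDist [DecidableEq ι] {Z : Type*} [Fintype Z] (idx : Z → (ι → ℤ))
    (hidx : Function.Injective idx) (P : Z → Prop) [DecidablePred P] (m : ι → ℤ) (s : ℕ)
    (hP : ∀ z', P z' → supDist m (idx z') ≤ s) :
    (univ.filter fun z' => P z').card ≤ (2 * s + 1) ^ Fintype.card ι := by
  classical
  calc (univ.filter fun z' => P z').card
      = ((univ.filter fun z' => P z').image idx).card := (card_image_of_injective _ hidx).symm
    _ ≤ (((univ : Finset Z).image idx).filter fun n => supDist m n ≤ s).card := by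
        refine card_le_card fun n hn => ?_
        rw [mem_image] at hn
        obtain ⟨z', hz', rfl⟩ := hn
        rw [mem_filter] at hz' ⊢
        exact ⟨mem_image_of_mem _ (mem_univ _), hP _ hz'.2⟩
    _ ≤ (2 * s + 1) ^ Fintype.card ι := card_filter_supDist_le _ _ s

/-- **`hadjcard` in the single-scale member: `≤ 3^{|ι|}` adjacent cubes** (`= 27` on `ι = Fin 3`).  The printed adjacency
— *"`□_j, □_{j+1}` should touch, possibly only on corners, and including the possibility `□_j = □_{j+1}`"* — is, for cubes
of one size labelled injectively by their indices in `ℤ^ι`, `supDist (idx □_j) (idx □_{j+1}) ≤ 1`; any relation `adj`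
implying it has `#{z′ : adj z z′} ≤ 3^{|ι|}`. [cite: Dimock2004QED3TorusII, §3.2 (132) p.22 L7–11; proof of Thm 1 Part III
p.25 L10–12 («we sum over paths. The factor `(O(1)M_0)^{−n}` is sufficient to control the sum»)] -/
theorem adjcard_le [DecidableEq ι] {Z : Type*} [Fintype Z] (idx : Z → (ι → ℤ)) (hidx : Function.Injective idx)
    (adj : Z → Z → Prop) [DecidableRel adj] (hadj : ∀ z z', adj z z' → supDist (idx z) (idx z') ≤ 1) (z : Z) :
    (univ.filter fun z' => adj z z').card ≤ 3 ^ Fintype.card ι := by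
  have h := card_filter_le_of_supDist idx hidx (adj z) (idx z) 1 (hadj z)
  simpa using h

end QED3PathMetric

end Literature.MathematicalPhysics.QuantumFieldTheory.Dimock2011to13
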